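import Literature.Analysis.Fourier.PorousFractalUncertainty
import Literature.Analysis.Fourier.FractalUncertaintyPrinciple
import HarnessLib

/-!
# Porous sets sit inside `δ`-regular sets with `δ < 1` (Dyatlov–Jin 2018 (Acta), Lemma 5.4;
# Dyatlov 2019, §2.2 Proposition 1(2)) — the finite-scale form, proved

Topic `Literature/Analysis/Fourier`. This is the "porous → regular" step of the fractal
uncertainty principle for porous sets ([DyatlovJinNonnenmacher2021, proof of Prop. 2.9, Step 4];
[Dyatlov2019, Prop. 1(2) and Thm. 3]; [DyatlovJin2018Acta, Lemma 5.4]): a `ν`-porous set is contained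
in a `δ(ν)`-regular set (`IsRegularSet`, [BourgainDyatlov2018, Def. 1.1]) with `δ(ν) < 1` and
regularity constant `C_R(ν)`.

We formalise the printed Cantor-type construction [DyatlovJin2018Acta, proof of Lemma 5.4] ("put
`L := ⌈2/ν⌉`; use the tree of intervals `I_{m,k} = [m L^{-k}, (m+1) L^{-k}]`; for `k ≤ k₀`, where
`L^{-1-k₀} < α₀ ≤ L^{-k₀}`, porosity gives a child `I_{n(m,k),k+1} ⊂ I_{m,k}` missing `Ω`; remove
it; the surviving intervals carry the natural measure `μ(I_{m,k}) = (L-1)^{-k}`; then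
`μ(I) ≤ 2L|I|^δ` for all `|I| ≤ 1` and `μ(I) ≥ |I|^δ/(2L)` for `I` centred on the set,
`δ = log(L-1)/log L`") in the FINITE-DEPTH form that the FUP on scales `α₀` to `1` needs: we stop
the construction at the level `n = k₀ + 1` (cells of size `L^{-n} < α₀`) and keep the surviving
closed cells whole. The resulting set `X` then contains `Ω` itself (not only `Ω ⊂ X(α₀)` as in the
infinite construction), is a finite union of closed intervals, and is `δ`-regular with constant
`2L` on scales `α₀` to `1` for the measure `μ = (L/(L-1))^n · vol|_X` (which gives every surviving
cell `I_{m,k}`, `k ≤ n`, mass exactly `(L-1)^{-k}`); below the bottom scale the two-sided estimate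
is checked directly (`|I| ∈ [α₀, 2L^{-n})`: `μ(I) ≥ (L/(L-1))^n |I|/2 ≥ |I|^δ/2`). To keep the sets
inside `[-1, 1]` (as `bourgainDyatlov2018_thm4` wants) the level-`0` cells are `[-1,0]` and `[0,1]`.

Main result: `exists_regular_superset_of_porous` — for `ν ∈ (0,1)` there are `δ ∈ [0,1)` and
`C_R ≥ 1` (namely `L = ⌈2/ν⌉₊`, `δ = log(L-1)/log L`, `C_R = 2L`) such that every `Ω ⊆ [-1,1]`
which is `ν`-porous on scales `α₀` to `1` (`0 < α₀ ≤ 1`) is contained in some `X ⊆ [-1,1]` which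
is `δ`-regular with constant `C_R` on scales `α₀` to `1`.

## References

* [DyatlovJin2018Acta] S. Dyatlov, L. Jin, *Semiclassical measures on hyperbolic surfaces have full
  support*, Acta Math. 220 (2018), 297–339 = arXiv:1705.05019, §5.1, Def. 5.1, Def. 5.2,
  Lemma 5.4 and its proof (materialised text: Lemma "4.4", pp. 10–11).
* [Dyatlov2019] S. Dyatlov, *An introduction to fractal uncertainty principle*, J. Math. Phys. 60
  (2019), 081505 = arXiv:1903.02599, §2.2 Prop. 1(2), Prop. 2; §2.3 Thm. 3.
* [DyatlovJinNonnenmacher2021] S. Dyatlov, L. Jin, S. Nonnenmacher, J. Amer. Math. Soc. 35 (2022)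
  = arXiv:1906.08923, §2.4, proof of Prop. 2.9, Step 4.
* [BourgainDyatlov2018] J. Bourgain, S. Dyatlov, Ann. of Math. 187 (2018), Def. 1.1, Lemma 2.1.
-/

noncomputable section

open _root_.MeasureTheory Set Real
open scoped ENNReal

namespace Literature.Analysis.Fourier

namespace PorousCover

/-! ### The tree of `L`-adic intervals -/

/-- The `L`-adic cell `I_{m,k} = [m L^{-k}, (m+1) L^{-k}]`. [cite: DyatlovJin2018Acta, proof of Lemma 5.4] -/
def ladic (L : ℕ) (k : ℕ) (m : ℤ) : Set ℝ :=
  Icc ((m : ℝ) / (L : ℝ) ^ k) (((m : ℝ) + 1) / (L : ℝ) ^ k)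

section LAdic

variable {L : ℕ}

/-- Unfolding lemma for `ladic`. [folklore] -/
theorem ladic_def (L : ℕ) (k : ℕ) (m : ℤ) :
    ladic L k m = Icc ((m : ℝ) / (L : ℝ) ^ k) (((m : ℝ) + 1) / (L : ℝ) ^ k) := rfl

/-- Cells are measurable. [folklore] -/
theorem measurableSet_ladic (L k : ℕ) (m : ℤ) : MeasurableSet (ladic L k m) := measurableSet_Icc

/-- Cells are closed. [folklore] -/
theorem isClosed_ladic (L k : ℕ) (m : ℤ) : IsClosed (ladic L k m) := isClosed_Icc

/-- `L^k > 0`. [folklore] -/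
private theorem Lpow_pos (hL : 2 ≤ L) (k : ℕ) : (0 : ℝ) < (L : ℝ) ^ k := by
  have : (0 : ℝ) < L := by exact_mod_cast (by omega : 0 < L)
  positivity

/-- `vol I_{m,k} = L^{-k}`. [folklore] -/
theorem volume_ladic (L k : ℕ) (m : ℤ) :
    volume (ladic L k m) = ENNReal.ofReal (1 / (L : ℝ) ^ k) := by
  rw [ladic, Real.volume_Icc]
  congr 1
  ring

/-- Points of a cell are within `L^{-k}` of each other. [folklore] -/
theorem dist_le_of_mem_ladic {k : ℕ} {m : ℤ} {x y : ℝ} (hx : x ∈ ladic L k m)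
    (hy : y ∈ ladic L k m) : |x - y| ≤ 1 / (L : ℝ) ^ k := by
  have h1 : ((m : ℝ) + 1) / (L : ℝ) ^ k = (m : ℝ) / (L : ℝ) ^ k + 1 / (L : ℝ) ^ k := by ring
  rw [ladic, h1] at hx hy
  rw [abs_le]
  constructor <;> linarith [hx.1, hx.2, hy.1, hy.2]

/-- A child cell lies in its parent: `I_{Lm+i,k+1} ⊆ I_{m,k}` for `0 ≤ i ≤ L-1`. [folklore] -/
theorem ladic_child_subset (hL : 2 ≤ L) (k : ℕ) (m : ℤ) {i : ℤ} (hi0 : 0 ≤ i) (hiL : i ≤ L - 1) :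
    ladic L (k + 1) (L * m + i) ⊆ ladic L k m := by
  have hLpos : (0 : ℝ) < L := by exact_mod_cast (by omega : 0 < L)
  have hpk := Lpow_pos hL k
  intro x hx
  rw [ladic, mem_Icc, pow_succ] at hx
  rw [ladic, mem_Icc]
  have hi0' : (0 : ℝ) ≤ i := by exact_mod_cast hi0
  have hiL' : (i : ℝ) ≤ L - 1 := by
    have : ((i : ℤ) : ℝ) ≤ ((L - 1 : ℤ) : ℝ) := by exact_mod_cast hiL
    simpa using this
  obtain ⟨hx1, hx2⟩ := hx
  push_cast at hx1 hx2
  constructor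
  · rw [div_le_iff₀ hpk]
    rw [div_le_iff₀ (by positivity)] at hx1
    have h' : (m : ℝ) * L ≤ x * (L : ℝ) ^ k * L := by linarith
    exact le_of_mul_le_mul_right h' hLpos
  · rw [le_div_iff₀ hpk]
    rw [le_div_iff₀ (by positivity)] at hx2
    have h' : x * (L : ℝ) ^ k * L ≤ ((m : ℝ) + 1) * L := by linarith
    exact le_of_mul_le_mul_right h' hLpos

/-- `I_{c,k+1} ⊆ I_{⌊c/L⌋,k}`. [folklore] -/
theorem ladic_succ_subset_ladic_ediv (hL : 2 ≤ L) (k : ℕ) (c : ℤ) :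
    ladic L (k + 1) c ⊆ ladic L k (c / L) := by
  have hL0 : (L : ℤ) ≠ 0 := by exact_mod_cast (by omega : L ≠ 0)
  have hdecomp : c = L * (c / L) + c % L := (Int.mul_ediv_add_emod c L).symm
  conv_lhs => rw [hdecomp]
  refine ladic_child_subset hL k (c / L) (Int.emod_nonneg c hL0) ?_
  have := Int.emod_lt_of_pos c (show (0 : ℤ) < L by omega)
  omega

/-- Iterated: `I_{c,k+d} ⊆ I_{⌊c/L^d⌋,k}`. [folklore] -/
theorem ladic_add_subset_ladic_ediv (hL : 2 ≤ L) (k d : ℕ) (c : ℤ) :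
    ladic L (k + d) c ⊆ ladic L k (c / (L : ℤ) ^ d) := by
  induction d generalizing c with
  | zero => simp
  | succ d ih =>
    have h1 : ladic L (k + (d + 1)) c ⊆ ladic L (k + d) (c / L) := by
      rw [← add_assoc]
      exact ladic_succ_subset_ladic_ediv hL (k + d) c
    have hcd : c / (L : ℤ) / (L : ℤ) ^ d = c / (L : ℤ) ^ (d + 1) := by
      rw [Int.ediv_ediv_of_nonneg (by positivity), pow_succ']
    rw [← hcd]
    exact h1.trans (ih (c / L))

/-- A cell is covered by its `L` children. [folklore] -/
theorem ladic_subset_iUnion_children (hL : 2 ≤ L) (k : ℕ) (m : ℤ) :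
    ladic L k m ⊆ ⋃ i ∈ Finset.range L, ladic L (k + 1) (L * m + (i : ℕ)) := by
  have hLpos : (0 : ℝ) < L := by exact_mod_cast (by omega : 0 < L)
  have hpk := Lpow_pos hL k
  have hpk1 := Lpow_pos hL (k + 1)
  intro x hx
  rw [ladic, mem_Icc, div_le_iff₀ hpk, le_div_iff₀ hpk] at hx
  -- `t = x L^{k+1} ∈ [Lm, Lm + L]`
  set t : ℝ := x * (L : ℝ) ^ (k + 1) with ht
  have ht1 : (L : ℝ) * m ≤ t := by rw [ht, pow_succ]; nlinarith [hx.1]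
  have ht2 : t ≤ (L : ℝ) * m + L := by rw [ht, pow_succ]; nlinarith [hx.2]
  -- the child index
  set c : ℤ := min ⌊t⌋ (L * m + (L - 1)) with hc
  have hc1 : (L : ℤ) * m ≤ c := by
    refine le_min (Int.le_floor.2 (by exact_mod_cast ht1)) (by omega)
  have hc2 : c ≤ L * m + (L - 1) := min_le_right _ _
  have hxc1 : (c : ℝ) ≤ t := ((Int.cast_le.2 (min_le_left _ _)).trans (Int.floor_le t))
  have hxc2 : t ≤ (c : ℝ) + 1 := by
    rcases le_total ⌊t⌋ (L * m + (L - 1)) with hle | hle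
    · rw [hc, min_eq_left hle]; exact (Int.lt_floor_add_one t).le
    · rw [hc, min_eq_right hle]; push_cast; linarith
  set i : ℕ := (c - L * m).toNat with hi
  have hic : (i : ℤ) = c - L * m := Int.toNat_of_nonneg (by omega)
  refine mem_iUnion₂.2 ⟨i, Finset.mem_range.2 (by omega), ?_⟩
  rw [ladic, mem_Icc, div_le_iff₀ hpk1, le_div_iff₀ hpk1]
  have : ((L * m + (i : ℕ) : ℤ) : ℝ) = c := by
    rw [show ((i : ℕ) : ℤ) = c - L * m from hic]; push_cast; ring
  rw [this]
  exact ⟨hxc1, hxc2⟩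

/-- Two distinct cells of the same level meet in a Lebesgue-null set (at most one point). [folklore] -/
theorem volume_ladic_inter_ladic (hL : 2 ≤ L) (k : ℕ) {m m' : ℤ} (hne : m ≠ m') :
    volume (ladic L k m ∩ ladic L k m') = 0 := by
  have hpk := Lpow_pos hL k
  wlog hlt : m < m' generalizing m m'
  · rw [inter_comm]; exact this hne.symm (lt_of_le_of_ne (not_lt.1 hlt) hne.symm)
  have hsub : ladic L k m ∩ ladic L k m' ⊆ Icc ((m' : ℝ) / (L : ℝ) ^ k) (((m : ℝ) + 1) / (L : ℝ) ^ k) := by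
    rintro x ⟨⟨_, h2⟩, ⟨h3, _⟩⟩; exact ⟨h3, h2⟩
  refine measure_mono_null hsub ?_
  rw [Real.volume_Icc, ENNReal.ofReal_eq_zero, ← sub_div]
  refine div_nonpos_of_nonpos_of_nonneg ?_ hpk.le
  have : (m : ℝ) + 1 ≤ m' := by exact_mod_cast hlt
  linarith

/-- A bottom cell `I_{c,k+d}` not descending from `I_{m,k}` meets it in a null set. [folklore] -/
theorem volume_ladic_inter_ladic_add (hL : 2 ≤ L) (k d : ℕ) {m c : ℤ}
    (hne : c / (L : ℤ) ^ d ≠ m) : volume (ladic L k m ∩ ladic L (k + d) c) = 0 :=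
  measure_mono_null (inter_subset_inter_right _ (ladic_add_subset_ladic_ediv hL k d c))
    (volume_ladic_inter_ladic hL k (Ne.symm hne))

end LAdic

/-! ### Surviving cells -/

/-- `Surv L rm k m`: the cell `I_{m,k}` survives the removal procedure with removal function `rm`
(`rm k m` = index of the child of `I_{m,k}` removed at step `k`), starting from the two level-`0`
cells `[-1,0]`, `[0,1]`: all its ancestors survive and it is not the removed child of its parent.
[cite: DyatlovJin2018Acta, proof of Lemma 5.4 (the sets `𝓜(k)`)] -/
def Surv (L : ℕ) (rm : ℕ → ℤ → ℤ) : ℕ → ℤ → Prop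
  | 0, m => m = -1 ∨ m = 0
  | k + 1, m => Surv L rm k (m / (L : ℤ)) ∧ m ≠ rm k (m / (L : ℤ))

section Surv

variable {L : ℕ} {rm : ℕ → ℤ → ℤ}

/-- Level `0`: the surviving cells are `[-1,0]` and `[0,1]`. [folklore] -/
@[simp] theorem surv_zero (m : ℤ) : Surv L rm 0 m ↔ (m = -1 ∨ m = 0) := Iff.rfl

/-- Unfolding the recursion of `Surv`. [folklore] -/
theorem surv_succ (k : ℕ) (m : ℤ) :
    Surv L rm (k + 1) m ↔ Surv L rm k (m / (L : ℤ)) ∧ m ≠ rm k (m / (L : ℤ)) := Iff.rfl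

/-- Ancestors of surviving cells survive. [cite: DyatlovJin2018Acta, §5.1, proof of Lemma 5.4] -/
theorem Surv.ediv_pow (hL : 2 ≤ L) {k d : ℕ} {m : ℤ} (h : Surv L rm (k + d) m) :
    Surv L rm k (m / (L : ℤ) ^ d) := by
  induction d generalizing m with
  | zero => simpa using h
  | succ d ih =>
    have h' : Surv L rm (k + d + 1) m := by rw [add_assoc]; exact h
    have := ih ((surv_succ _ _).1 h').1
    rwa [Int.ediv_ediv_of_nonneg (by positivity), ← pow_succ'] at this

/-- Surviving cells of level `k` have indices in `[-L^k, L^k)`. [cite: DyatlovJin2018Acta, §5.1, proof of Lemma 5.4] -/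
theorem Surv.bounds (hL : 2 ≤ L) {k : ℕ} {m : ℤ} (h : Surv L rm k m) :
    -(L : ℤ) ^ k ≤ m ∧ m < (L : ℤ) ^ k := by
  induction k generalizing m with
  | zero => rcases h with rfl | rfl <;> simp
  | succ k ih =>
    obtain ⟨h1, h2⟩ := ih ((surv_succ _ _).1 h).1
    have hLpos : (0 : ℤ) < L := by exact_mod_cast (by omega : 0 < L)
    have e1 : (L : ℤ) * (m / L) ≤ m := Int.mul_ediv_self_le hLpos.ne'
    have e2 : m < (L : ℤ) * (m / L) + L := Int.lt_mul_ediv_self_add hLpos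
    have h2' : m / (L : ℤ) + 1 ≤ (L : ℤ) ^ k := h2
    constructor
    · calc -(L : ℤ) ^ (k + 1) = L * (-(L : ℤ) ^ k) := by ring
        _ ≤ L * (m / L) := mul_le_mul_of_nonneg_left h1 hLpos.le
        _ ≤ m := e1
    · calc m < (L : ℤ) * (m / L) + L := e2
        _ = L * (m / L + 1) := by ring
        _ ≤ L * (L : ℤ) ^ k := mul_le_mul_of_nonneg_left h2' hLpos.le
        _ = (L : ℤ) ^ (k + 1) := by ring

/-- Finitely many cells survive at each level. [folklore] -/
theorem surv_finite (hL : 2 ≤ L) (k : ℕ) : {m : ℤ | Surv L rm k m}.Finite :=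
  (Set.finite_Ico (-(L : ℤ) ^ k) ((L : ℤ) ^ k)).subset fun _ hm => Surv.bounds hL hm

/-- The child `Lm + i` (`0 ≤ i < L`) has parent index `m`. [folklore] -/
theorem child_ediv (hL : 2 ≤ L) (m : ℤ) {i : ℤ} (hi0 : 0 ≤ i) (hiL : i < L) :
    (L * m + i) / (L : ℤ) = m := by
  have hL0 : (L : ℤ) ≠ 0 := by exact_mod_cast (by omega : L ≠ 0)
  rw [Int.mul_add_ediv_left m i hL0, Int.ediv_eq_zero_of_lt hi0 hiL, add_zero]

/-- A non-removed child of a surviving cell survives. [cite: DyatlovJin2018Acta, §5.1, proof of Lemma 5.4] -/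
theorem Surv.child (hL : 2 ≤ L) {k : ℕ} {m : ℤ} (h : Surv L rm k m) {i : ℤ} (hi0 : 0 ≤ i)
    (hiL : i < L) (hne : L * m + i ≠ rm k m) : Surv L rm (k + 1) (L * m + i) := by
  rw [surv_succ, child_ediv hL m hi0 hiL]
  exact ⟨h, hne⟩

/-- Some cell survives at every level (follow a non-removed child; `L ≥ 2`). [cite: DyatlovJin2018Acta, §5.1, proof of Lemma 5.4] -/
theorem surv_nonempty (hL : 2 ≤ L) (k : ℕ) : ∃ m, Surv L rm k m := by
  induction k with
  | zero => exact ⟨0, Or.inr rfl⟩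
  | succ k ih =>
    obtain ⟨m, hm⟩ := ih
    by_cases h0 : (L : ℤ) * m + 0 = rm k m
    · refine ⟨L * m + 1, hm.child hL zero_le_one (by exact_mod_cast (show 1 < L by omega)) ?_⟩
      omega
    · exact ⟨L * m + 0, hm.child hL le_rfl (by exact_mod_cast (show 0 < L by omega)) h0⟩

end Surv

/-! ### The cover and its natural measure -/

/-- The finite-depth Cantor-type set: the union of the surviving closed cells of level `n`.
[cite: DyatlovJin2018Acta, proof of Lemma 5.4 (`⋂_{k<n} X̄_k = ⋃_{m ∈ 𝓜(n)} I_{m,n}`)] -/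
def cover (L : ℕ) (rm : ℕ → ℤ → ℤ) (n : ℕ) : Set ℝ :=
  ⋃ m ∈ {m : ℤ | Surv L rm n m}, ladic L n m

section Cover

variable {L : ℕ} {rm : ℕ → ℤ → ℤ} {n : ℕ}

/-- Membership in the cover. [folklore] -/
theorem mem_cover {x : ℝ} : x ∈ cover L rm n ↔ ∃ m : ℤ, Surv L rm n m ∧ x ∈ ladic L n m := by
  simp only [cover, mem_iUnion₂, mem_setOf_eq, exists_prop]

/-- The cover is closed (a finite union of closed cells). [folklore] -/
theorem isClosed_cover (hL : 2 ≤ L) : IsClosed (cover L rm n) :=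
  (surv_finite hL n).isClosed_biUnion fun m _ => isClosed_ladic L n m

/-- The cover is measurable. [folklore] -/
theorem measurableSet_cover (hL : 2 ≤ L) : MeasurableSet (cover L rm n) :=
  (isClosed_cover hL).measurableSet

/-- The cover is nonempty. [folklore] -/
theorem cover_nonempty (hL : 2 ≤ L) : (cover L rm n).Nonempty := by
  obtain ⟨m, hm⟩ := surv_nonempty (rm := rm) hL n
  refine ⟨(m : ℝ) / (L : ℝ) ^ n, mem_cover.2 ⟨m, hm, ?_⟩⟩
  rw [ladic, mem_Icc]
  exact ⟨le_rfl, div_le_div_of_nonneg_right (by linarith) (Lpow_pos hL n).le⟩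

/-- Surviving bottom cells lie in the cover. [folklore] -/
theorem ladic_subset_cover {m : ℤ} (hm : Surv L rm n m) : ladic L n m ⊆ cover L rm n :=
  fun _ hx => mem_cover.2 ⟨m, hm, hx⟩

/-- The cover lies in `[-1, 1]` (its level-`0` cells are `[-1,0]` and `[0,1]`). [cite: DyatlovJin2018Acta, §5.1, proof of Lemma 5.4] -/
theorem cover_subset_Icc (hL : 2 ≤ L) : cover L rm n ⊆ Icc (-1) 1 := by
  intro x hx
  obtain ⟨c, hc, hxc⟩ := mem_cover.1 hx
  have h0 : Surv L rm 0 (c / (L : ℤ) ^ n) := Surv.ediv_pow hL (k := 0) (by simpa using hc)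
  have hx0 : x ∈ ladic L 0 (c / (L : ℤ) ^ n) :=
    ladic_add_subset_ladic_ediv hL 0 n c (by simpa using hxc)
  rw [ladic, pow_zero, div_one, div_one] at hx0
  rcases (surv_zero _).1 h0 with h | h <;> rw [h] at hx0 <;> push_cast at hx0
  · exact ⟨hx0.1, by linarith [hx0.2]⟩
  · exact ⟨by linarith [hx0.1], by linarith [hx0.2]⟩

/-- Cells that do not survive carry no mass of the cover. [cite: DyatlovJin2018Acta, §5.1, proof of Lemma 5.4] -/
theorem volume_ladic_inter_cover_of_not_surv (hL : 2 ≤ L) {k : ℕ} (hk : k ≤ n) {m : ℤ}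
    (hm : ¬ Surv L rm k m) : volume (ladic L k m ∩ cover L rm n) = 0 := by
  obtain ⟨d, rfl⟩ := Nat.exists_eq_add_of_le hk
  rw [cover, inter_iUnion₂, measure_biUnion_null_iff (surv_finite hL _).countable]
  intro c hc
  refine volume_ladic_inter_ladic_add hL k d fun heq => hm ?_
  rw [← heq]
  exact Surv.ediv_pow hL hc

/-- **Upper mass bound:** `vol(I_{m,k} ∩ X) ≤ (L-1)^{n-k} L^{-n}` for all cells with `k ≤ n`
(each cell has a child carrying no mass). [cite: DyatlovJin2018Acta, §5.1, proof of Lemma 5.4] -/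
theorem volume_ladic_inter_cover_le (hL : 2 ≤ L)
    (hrm : ∀ k < n, ∀ m : ℤ, (L : ℤ) * m ≤ rm k m ∧ rm k m ≤ L * m + (L - 1)) :
    ∀ d ≤ n, ∀ m : ℤ, volume (ladic L (n - d) m ∩ cover L rm n) ≤
      ENNReal.ofReal (((L : ℝ) - 1) ^ d / (L : ℝ) ^ n) := by
  intro d
  induction d with
  | zero =>
    intro _ m
    rw [Nat.sub_zero, pow_zero]
    exact (measure_mono inter_subset_left).trans (le_of_eq (volume_ladic L n m))
  | succ d ih =>
    intro hd m
    have hk : n - (d + 1) + 1 = n - d := by omega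
    have hklt : n - (d + 1) < n := by omega
    set k := n - (d + 1) with hkdef
    -- some child carries no mass
    obtain ⟨i₀, hi₀L, hi₀⟩ : ∃ i₀ : ℕ, i₀ < L ∧
        volume (ladic L (k + 1) (L * m + (i₀ : ℕ)) ∩ cover L rm n) = 0 := by
      by_cases hs : Surv L rm k m
      · obtain ⟨h1, h2⟩ := hrm k hklt m
        refine ⟨(rm k m - L * m).toNat, by omega, ?_⟩
        have hci : ((L : ℤ) * m + ((rm k m - L * m).toNat : ℕ)) = rm k m := by
          rw [Int.toNat_of_nonneg (by omega)]
          ring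
        rw [hci]
        refine volume_ladic_inter_cover_of_not_surv hL (by omega) fun hs' => ?_
        rw [surv_succ] at hs'
        have hdiv : rm k m / (L : ℤ) = m := by
          have e : rm k m = L * m + (rm k m - L * m) := by ring
          rw [e]
          exact child_ediv hL m (by omega) (by omega)
        exact hs'.2 (by rw [hdiv])
      · refine ⟨0, by omega, volume_ladic_inter_cover_of_not_surv hL (by omega) fun hs' => hs ?_⟩
        rw [surv_succ, child_ediv hL m (by simp) (by exact_mod_cast (show 0 < L by omega))] at hs'
        exact hs'.1
    -- sum over the children
    calc volume (ladic L k m ∩ cover L rm n)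
        ≤ volume (⋃ i ∈ Finset.range L, ladic L (k + 1) (L * m + (i : ℕ)) ∩ cover L rm n) := by
          refine measure_mono ?_
          rw [← iUnion₂_inter]
          exact inter_subset_inter_left _ (ladic_subset_iUnion_children hL k m)
      _ ≤ ∑ i ∈ Finset.range L, volume (ladic L (k + 1) (L * m + (i : ℕ)) ∩ cover L rm n) :=
          measure_biUnion_finset_le _ _
      _ = ∑ i ∈ (Finset.range L).erase i₀,
            volume (ladic L (k + 1) (L * m + (i : ℕ)) ∩ cover L rm n) := by
          rw [← Finset.sum_erase_add _ _ (Finset.mem_range.2 hi₀L), hi₀, add_zero]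
      _ ≤ ∑ _i ∈ (Finset.range L).erase i₀, ENNReal.ofReal (((L : ℝ) - 1) ^ d / (L : ℝ) ^ n) := by
          refine Finset.sum_le_sum fun i _ => ?_
          rw [hk]
          exact ih (by omega) _
      _ = ENNReal.ofReal (((L : ℝ) - 1) ^ (d + 1) / (L : ℝ) ^ n) := by
          rw [Finset.sum_const, Finset.card_erase_of_mem (Finset.mem_range.2 hi₀L),
            Finset.card_range, nsmul_eq_mul]
          have hL1 : ((L - 1 : ℕ) : ℝ) = (L : ℝ) - 1 := by
            rw [Nat.cast_sub (by omega)]; simp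
          rw [show ((L - 1 : ℕ) : ℝ≥0∞) = ENNReal.ofReal ((L : ℝ) - 1) by
                rw [← hL1, ENNReal.ofReal_natCast],
            ← ENNReal.ofReal_mul (by linarith [show (2 : ℝ) ≤ L by exact_mod_cast hL])]
          congr 1
          ring

/-- **Lower mass bound:** a surviving cell `I_{m,k}`, `k ≤ n`, has `vol(I_{m,k} ∩ X) ≥
(L-1)^{n-k} L^{-n}` (its `L - 1` non-removed children survive and overlap in null sets). [cite: DyatlovJin2018Acta, §5.1, proof of Lemma 5.4] -/
theorem le_volume_ladic_inter_cover (hL : 2 ≤ L)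
    (hrm : ∀ k < n, ∀ m : ℤ, (L : ℤ) * m ≤ rm k m ∧ rm k m ≤ L * m + (L - 1)) :
    ∀ d ≤ n, ∀ m : ℤ, Surv L rm (n - d) m →
      ENNReal.ofReal (((L : ℝ) - 1) ^ d / (L : ℝ) ^ n) ≤ volume (ladic L (n - d) m ∩ cover L rm n) := by
  intro d
  induction d with
  | zero =>
    intro _ m hm
    rw [Nat.sub_zero] at hm ⊢
    rw [pow_zero, inter_eq_left.2 (ladic_subset_cover hm), volume_ladic L n m]
  | succ d ih =>
    intro hd m hm
    have hk : n - (d + 1) + 1 = n - d := by omega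
    have hklt : n - (d + 1) < n := by omega
    set k := n - (d + 1) with hkdef
    obtain ⟨h1, h2⟩ := hrm k hklt m
    set i₀ : ℕ := (rm k m - L * m).toNat with hi₀def
    have hi₀ : ((i₀ : ℕ) : ℤ) = rm k m - L * m := Int.toNat_of_nonneg (by omega)
    have hi₀L : i₀ < L := by omega
    set s : Finset ℕ := (Finset.range L).erase i₀ with hs
    -- the non-removed children survive
    have hsurv : ∀ i ∈ s, Surv L rm (k + 1) (L * m + (i : ℕ)) := by
      intro i hi
      obtain ⟨hi1, hi2⟩ := Finset.mem_erase.1 hi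
      refine hm.child hL (by positivity) (by exact_mod_cast Finset.mem_range.1 hi2) fun heq => hi1 ?_
      have : ((i : ℕ) : ℤ) = (i₀ : ℤ) := by rw [hi₀]; omega
      exact_mod_cast this
    calc ENNReal.ofReal (((L : ℝ) - 1) ^ (d + 1) / (L : ℝ) ^ n)
        = ∑ _i ∈ s, ENNReal.ofReal (((L : ℝ) - 1) ^ d / (L : ℝ) ^ n) := by
          rw [Finset.sum_const, hs, Finset.card_erase_of_mem (Finset.mem_range.2 hi₀L),
            Finset.card_range, nsmul_eq_mul]
          have hL1 : ((L - 1 : ℕ) : ℝ) = (L : ℝ) - 1 := by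
            rw [Nat.cast_sub (by omega)]; simp
          rw [show ((L - 1 : ℕ) : ℝ≥0∞) = ENNReal.ofReal ((L : ℝ) - 1) by
                rw [← hL1, ENNReal.ofReal_natCast],
            ← ENNReal.ofReal_mul (by linarith [show (2 : ℝ) ≤ L by exact_mod_cast hL])]
          congr 1
          ring
      _ ≤ ∑ i ∈ s, volume (ladic L (k + 1) (L * m + (i : ℕ)) ∩ cover L rm n) := by
          refine Finset.sum_le_sum fun i hi => ?_
          have := ih (by omega) (L * m + (i : ℕ)) (by rw [← hk]; exact hsurv i hi)
          rwa [← hk] at this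
      _ = volume (⋃ i ∈ s, ladic L (k + 1) (L * m + (i : ℕ)) ∩ cover L rm n) := by
          refine (measure_biUnion_finset₀ ?_ fun i _ =>
            ((measurableSet_ladic L _ _).inter (measurableSet_cover hL)).nullMeasurableSet).symm
          intro i _ j _ hij
          change volume ((ladic L (k + 1) (L * m + (i : ℕ)) ∩ cover L rm n) ∩
            (ladic L (k + 1) (L * m + (j : ℕ)) ∩ cover L rm n)) = 0
          have hij' : (L : ℤ) * m + (i : ℕ) ≠ L * m + (j : ℕ) := by
            have : ((i : ℕ) : ℤ) ≠ ((j : ℕ) : ℤ) := by exact_mod_cast hij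
            omega
          exact measure_mono_null
            (t := ladic L (k + 1) (L * m + (i : ℕ)) ∩ ladic L (k + 1) (L * m + (j : ℕ)))
            (fun x hx => ⟨hx.1.1, hx.2.1⟩) (volume_ladic_inter_ladic hL (k + 1) hij')
      _ ≤ volume (ladic L k m ∩ cover L rm n) := by
          refine measure_mono ?_
          rw [← iUnion₂_inter]
          refine inter_subset_inter_left _ (iUnion₂_subset fun i hi => ?_)
          refine ladic_child_subset hL k m (by positivity) ?_
          have := Finset.mem_range.1 (Finset.mem_erase.1 hi).2
          omega

end Cover

/-! ### The natural measure `μ = (L/(L-1))^n · vol|_X` -/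

/-- The natural measure of the finite-depth Cantor set: `(L/(L-1))^n` times Lebesgue measure
restricted to it, so that each surviving cell `I_{m,k}`, `k ≤ n`, gets mass `(L-1)^{-k}`.
[cite: DyatlovJin2018Acta, proof of Lemma 5.4 (`μ_X(I_{m,k}) = (L-1)^{-k}`)] -/
def coverMeasure (L : ℕ) (rm : ℕ → ℤ → ℤ) (n : ℕ) : Measure ℝ :=
  ENNReal.ofReal ((L : ℝ) ^ n / ((L : ℝ) - 1) ^ n) • volume.restrict (cover L rm n)

section CoverMeasure

variable {L : ℕ} {rm : ℕ → ℤ → ℤ} {n : ℕ}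

/-- `μ(A) = (L/(L-1))^n vol(A ∩ X)`. [folklore] -/
theorem coverMeasure_apply {A : Set ℝ} (hA : MeasurableSet A) :
    coverMeasure L rm n A =
      ENNReal.ofReal ((L : ℝ) ^ n / ((L : ℝ) - 1) ^ n) * volume (A ∩ cover L rm n) := by
  rw [coverMeasure, Measure.smul_apply, Measure.restrict_apply hA, smul_eq_mul]

/-- `μ` is supported on the cover. [folklore] -/
theorem coverMeasure_compl (hL : 2 ≤ L) : coverMeasure L rm n (cover L rm n)ᶜ = 0 := by
  rw [coverMeasure_apply (measurableSet_cover hL).compl, compl_inter_self, measure_empty, mul_zero]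

/-- `μ(I_{m,k}) ≤ (L-1)^{-k}` for every cell of level `k ≤ n`. [cite: DyatlovJin2018Acta, §5.1, proof of Lemma 5.4] -/
theorem coverMeasure_ladic_le (hL : 2 ≤ L)
    (hrm : ∀ k < n, ∀ m : ℤ, (L : ℤ) * m ≤ rm k m ∧ rm k m ≤ L * m + (L - 1))
    {k : ℕ} (hk : k ≤ n) (m : ℤ) :
    coverMeasure L rm n (ladic L k m) ≤ ENNReal.ofReal (1 / ((L : ℝ) - 1) ^ k) := by
  have hq : (0 : ℝ) < (L : ℝ) - 1 := by
    have : (2 : ℝ) ≤ L := by exact_mod_cast hL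
    linarith
  have hb := volume_ladic_inter_cover_le hL hrm (n - k) (Nat.sub_le n k) m
  rw [Nat.sub_sub_self hk] at hb
  rw [coverMeasure_apply (measurableSet_ladic L k m)]
  calc ENNReal.ofReal ((L : ℝ) ^ n / ((L : ℝ) - 1) ^ n) * volume (ladic L k m ∩ cover L rm n)
      ≤ ENNReal.ofReal ((L : ℝ) ^ n / ((L : ℝ) - 1) ^ n) *
          ENNReal.ofReal (((L : ℝ) - 1) ^ (n - k) / (L : ℝ) ^ n) := by gcongr
    _ = ENNReal.ofReal (1 / ((L : ℝ) - 1) ^ k) := by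
        rw [← ENNReal.ofReal_mul (by positivity)]
        congr 1
        have hLn : (L : ℝ) ^ n ≠ 0 := (Lpow_pos hL n).ne'
        have hqn : ((L : ℝ) - 1) ^ n = ((L : ℝ) - 1) ^ k * ((L : ℝ) - 1) ^ (n - k) := by
          rw [← pow_add, Nat.add_sub_cancel' hk]
        rw [hqn]
        field_simp

/-- `μ(I_{m,k}) ≥ (L-1)^{-k}` for every SURVIVING cell of level `k ≤ n`. [cite: DyatlovJin2018Acta, §5.1, proof of Lemma 5.4] -/
theorem le_coverMeasure_ladic (hL : 2 ≤ L)
    (hrm : ∀ k < n, ∀ m : ℤ, (L : ℤ) * m ≤ rm k m ∧ rm k m ≤ L * m + (L - 1))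
    {k : ℕ} (hk : k ≤ n) {m : ℤ} (hm : Surv L rm k m) :
    ENNReal.ofReal (1 / ((L : ℝ) - 1) ^ k) ≤ coverMeasure L rm n (ladic L k m) := by
  have hq : (0 : ℝ) < (L : ℝ) - 1 := by
    have : (2 : ℝ) ≤ L := by exact_mod_cast hL
    linarith
  have hm' : Surv L rm (n - (n - k)) m := by rwa [Nat.sub_sub_self hk]
  have hb := le_volume_ladic_inter_cover hL hrm (n - k) (Nat.sub_le n k) m hm'
  rw [Nat.sub_sub_self hk] at hb
  rw [coverMeasure_apply (measurableSet_ladic L k m)]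
  calc ENNReal.ofReal (1 / ((L : ℝ) - 1) ^ k)
      = ENNReal.ofReal ((L : ℝ) ^ n / ((L : ℝ) - 1) ^ n) *
          ENNReal.ofReal (((L : ℝ) - 1) ^ (n - k) / (L : ℝ) ^ n) := by
        rw [← ENNReal.ofReal_mul (by positivity)]
        congr 1
        have hLn : (L : ℝ) ^ n ≠ 0 := (Lpow_pos hL n).ne'
        have hqn : ((L : ℝ) - 1) ^ n = ((L : ℝ) - 1) ^ k * ((L : ℝ) - 1) ^ (n - k) := by
          rw [← pow_add, Nat.add_sub_cancel' hk]
        rw [hqn]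
        field_simp
    _ ≤ ENNReal.ofReal ((L : ℝ) ^ n / ((L : ℝ) - 1) ^ n) * volume (ladic L k m ∩ cover L rm n) := by
        gcongr

end CoverMeasure

/-! ### The removal function from porosity; the cover contains `Ω` -/

section Removal

variable {L : ℕ} {n : ℕ} {Ω : Set ℝ} {ν α₀ : ℝ}

/-- **The pores.** If `Ω` is `ν`-porous on scales `α₀` to `1`, `ν L ≥ 2`, and the levels `k < n`
have cell size `L^{-k} ≥ α₀`, then every cell `I_{m,k}`, `k < n`, has a child `I_{c,k+1}` with
`I_{c,k+1} ∩ Ω = ∅` ("since `|J| = ν|I_{m,k}| ≥ 2L^{-k-1}` one can find `n` such that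
`I_{n,k+1} ⊂ J`"). [cite: DyatlovJin2018Acta, §5.1, proof of Lemma 5.4 (the claim `I_{n(m,k),k+1} ⊂ I_{m,k}`, `I_{n(m,k),k+1} ∩ Ω = ∅`)] -/
theorem exists_removal (hL : 2 ≤ L) (hνL : 2 ≤ ν * L) (hP : IsPorousOnScales Ω ν α₀ 1)
    (hscale : ∀ k < n, α₀ ≤ 1 / (L : ℝ) ^ k) :
    ∃ rm : ℕ → ℤ → ℤ, (∀ k < n, ∀ m : ℤ, (L : ℤ) * m ≤ rm k m ∧ rm k m ≤ L * m + (L - 1)) ∧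
      (∀ k < n, ∀ m : ℤ, Disjoint (ladic L (k + 1) (rm k m)) Ω) := by
  have hLpos : (0 : ℝ) < L := by exact_mod_cast (by omega : 0 < L)
  have hL1 : (1 : ℝ) ≤ L := by exact_mod_cast (by omega : 1 ≤ L)
  have key : ∀ k : ℕ, ∀ m : ℤ, ∃ c : ℤ, k < n →
      ((L : ℤ) * m ≤ c ∧ c ≤ L * m + (L - 1)) ∧ Disjoint (ladic L (k + 1) c) Ω := by
    intro k m
    by_cases hk : k < n
    swap
    · exact ⟨0, fun h => absurd h hk⟩
    have hpk := Lpow_pos hL k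
    have hpk1 := Lpow_pos hL (k + 1)
    -- porosity applied to the cell `I_{m,k}`
    have hlen : ((m : ℝ) + 1) / (L : ℝ) ^ k - (m : ℝ) / (L : ℝ) ^ k = 1 / (L : ℝ) ^ k := by ring
    obtain ⟨c', d', hc', hd', hdc', hdisj⟩ := hP ((m : ℝ) / (L : ℝ) ^ k) (((m : ℝ) + 1) / (L : ℝ) ^ k)
      (by rw [← sub_pos, hlen]; positivity) (by rw [hlen]; exact hscale k hk)
      (by rw [hlen, div_le_one hpk]; exact one_le_pow₀ hL1)
    rw [hlen] at hdc'
    -- the child cell `I_{c,k+1} ⊆ [c', d']`, `c = ⌈c' L^{k+1}⌉`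
    set c : ℤ := ⌈c' * (L : ℝ) ^ (k + 1)⌉ with hc
    have hc1 : c' * (L : ℝ) ^ (k + 1) ≤ c := Int.le_ceil _
    have hc2 : (c : ℝ) < c' * (L : ℝ) ^ (k + 1) + 1 := Int.ceil_lt_add_one _
    have hpore : 2 / (L : ℝ) ^ (k + 1) ≤ d' - c' := by
      rw [hdc', pow_succ]
      rw [div_le_iff₀ (by positivity)]
      calc (2 : ℝ) = 2 / (L : ℝ) ^ k * (L : ℝ) ^ k := by field_simp
        _ ≤ ν * (1 / (L : ℝ) ^ k) * ((L : ℝ) ^ k * L) := by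
            rw [show ν * (1 / (L : ℝ) ^ k) * ((L : ℝ) ^ k * L) = (ν * L) / (L : ℝ) ^ k * (L : ℝ) ^ k
              by ring]
            gcongr
    have hsub : ladic L (k + 1) c ⊆ Icc c' d' := by
      intro x hx
      rw [ladic, mem_Icc, div_le_iff₀ hpk1, le_div_iff₀ hpk1] at hx
      rw [div_le_iff₀ hpk1] at hpore
      constructor
      · nlinarith [hx.1]
      · nlinarith [hx.2]
    refine ⟨c, fun _ => ⟨⟨?_, ?_⟩, hdisj.mono_left hsub⟩⟩
    · -- `L m ≤ c`: `c ≥ c' L^{k+1} ≥ (m/L^k) L^{k+1} = L m`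
      have : ((L : ℤ) * m : ℤ) ≤ (c : ℝ) := by
        push_cast
        calc (L : ℝ) * m = (m : ℝ) / (L : ℝ) ^ k * (L : ℝ) ^ (k + 1) := by
              rw [pow_succ]; field_simp
          _ ≤ c' * (L : ℝ) ^ (k + 1) := by gcongr
          _ ≤ c := hc1
      exact_mod_cast this
    · -- `c ≤ L m + L - 1`: `c + 1 ≤ d' L^{k+1} ≤ ((m+1)/L^k) L^{k+1} = L (m + 1)`
      have h1 : (c : ℝ) + 1 ≤ d' * (L : ℝ) ^ (k + 1) := by
        rw [div_le_iff₀ hpk1] at hpore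
        linarith
      have h2 : d' * (L : ℝ) ^ (k + 1) ≤ (L : ℝ) * m + L := by
        calc d' * (L : ℝ) ^ (k + 1) ≤ ((m : ℝ) + 1) / (L : ℝ) ^ k * (L : ℝ) ^ (k + 1) := by gcongr
          _ = (L : ℝ) * m + L := by rw [pow_succ]; field_simp
      have : ((c + 1 : ℤ) : ℝ) ≤ ((L * m + L : ℤ) : ℝ) := by push_cast; linarith
      have := (Int.cast_le (R := ℝ)).1 this
      omega
  choose rm hrm using key
  exact ⟨rm, fun k hk m => ((hrm k m) hk).1, fun k hk m => ((hrm k m) hk).2⟩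

variable {rm : ℕ → ℤ → ℤ}

/-- **`Ω ⊆ X`.** A point of `Ω ⊆ [-1,1]` lies in a surviving cell of every level `k ≤ n`: it is
never in a removed cell, those being disjoint from `Ω`. [cite: DyatlovJin2018Acta, §5.1, proof of Lemma 5.4 ("we have `Ω ⊂ X_k` when `0 ≤ k ≤ k₀`")] -/
theorem subset_cover (hL : 2 ≤ L) (hΩ : Ω ⊆ Icc (-1) 1)
    (hrm2 : ∀ k < n, ∀ m : ℤ, Disjoint (ladic L (k + 1) (rm k m)) Ω) : Ω ⊆ cover L rm n := by
  intro x hx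
  suffices H : ∀ k ≤ n, ∃ m : ℤ, Surv L rm k m ∧ x ∈ ladic L k m by
    obtain ⟨m, hm, hxm⟩ := H n le_rfl
    exact mem_cover.2 ⟨m, hm, hxm⟩
  intro k
  induction k with
  | zero =>
    intro _
    obtain ⟨hx1, hx2⟩ := hΩ hx
    by_cases h0 : x ≤ 0
    · refine ⟨-1, Or.inl rfl, ?_⟩
      rw [ladic, mem_Icc]; push_cast; simp only [pow_zero, div_one]
      constructor <;> linarith
    · refine ⟨0, Or.inr rfl, ?_⟩
      rw [ladic, mem_Icc]; push_cast; simp only [pow_zero, div_one]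
      constructor <;> linarith
  | succ k ih =>
    intro hk
    obtain ⟨m, hm, hxm⟩ := ih (by omega)
    obtain ⟨i, hi, hxi⟩ := mem_iUnion₂.1 (ladic_subset_iUnion_children hL k m hxm)
    have hiL : ((i : ℕ) : ℤ) < L := by exact_mod_cast Finset.mem_range.1 hi
    refine ⟨L * m + (i : ℕ), hm.child hL (by positivity) hiL fun heq => ?_, hxi⟩
    rw [heq] at hxi
    exact Set.disjoint_left.1 (hrm2 k (by omega) m) hxi hx

end Removal

/-! ### The exponent `δ = log(L-1)/log L` -/

section Delta

variable {L : ℕ}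

/-- `L^δ = L - 1`. [folklore] -/
theorem rpow_delta (hL : 2 ≤ L) :
    (L : ℝ) ^ (Real.log ((L : ℝ) - 1) / Real.log L) = (L : ℝ) - 1 := by
  have hL1 : (1 : ℝ) < L := by exact_mod_cast (show 1 < L by omega)
  have hL2 : (2 : ℝ) ≤ L := by exact_mod_cast hL
  have hq : (0 : ℝ) < (L : ℝ) - 1 := by linarith
  have hlog : Real.log (L : ℝ) ≠ 0 := (Real.log_pos hL1).ne'
  rw [Real.rpow_def_of_pos (by linarith),
    show Real.log (L : ℝ) * (Real.log ((L : ℝ) - 1) / Real.log L) = Real.log ((L : ℝ) - 1) by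
      field_simp,
    Real.exp_log hq]

/-- `δ ≥ 0`. [folklore] -/
theorem delta_nonneg (hL : 2 ≤ L) : 0 ≤ Real.log ((L : ℝ) - 1) / Real.log L := by
  have hL2 : (2 : ℝ) ≤ L := by exact_mod_cast hL
  exact div_nonneg (Real.log_nonneg (by linarith)) (Real.log_nonneg (by linarith))

/-- `δ < 1`. [folklore] -/
theorem delta_lt_one (hL : 2 ≤ L) : Real.log ((L : ℝ) - 1) / Real.log L < 1 := by
  have hL1 : (1 : ℝ) < L := by exact_mod_cast (show 1 < L by omega)
  have hL2 : (2 : ℝ) ≤ L := by exact_mod_cast hL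
  rw [div_lt_one (Real.log_pos hL1)]
  exact Real.log_lt_log (by linarith) (by linarith)

/-- `(L^{-k})^δ = (L-1)^{-k}`. [folklore] -/
theorem one_div_pow_rpow_delta (hL : 2 ≤ L) (k : ℕ) :
    (1 / (L : ℝ) ^ k) ^ (Real.log ((L : ℝ) - 1) / Real.log L) = 1 / ((L : ℝ) - 1) ^ k := by
  have hL0 : (0 : ℝ) ≤ L := by positivity
  rw [one_div, Real.inv_rpow (pow_nonneg hL0 k), ← Real.rpow_natCast (L : ℝ) k,
    ← Real.rpow_mul hL0, mul_comm, Real.rpow_mul hL0, rpow_delta hL, Real.rpow_natCast, one_div]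

end Delta

/-! ### Regularity of the cover on scales `α₀` to `1` -/

section Regularity

variable {L : ℕ} {rm : ℕ → ℤ → ℤ} {n : ℕ}

/-- **The finite-depth Cantor set is `δ`-regular with constant `2L` on scales `α₀` to `1`**
(`δ = log(L-1)/log L`), provided the bottom cells are smaller than `α₀` (`L^{-n} < α₀`).
Upper bound as printed ("`I ⊂ I_{m,k} ∪ I_{m+1,k}`, `μ_X(I) ≤ 2L^{-δk} ≤ 2L|I|^δ`"); lower bound
as printed for `|I| ≥ 2L^{-n}` ("choose `m ∈ 𝓜(k+1)` with `x ∈ I_{m,k+1}`, then `I_{m,k+1} ⊂ I`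
and `μ_X(I) ≥ L^{-δ(k+1)} ≥ |I|^δ/(2L)`"), and directly from the density `(L/(L-1))^n` of `μ`
on the bottom cells for `α₀ ≤ |I| < 2L^{-n}`. [cite: DyatlovJin2018Acta, §5.1, proof of Lemma 5.4 (the two displayed estimates `μ_X(I) ≤ 2L·|I|^δ` and `μ_X(I) ≥ |I|^δ/(2L)`)] -/
theorem isRegularSet_cover (hL : 2 ≤ L)
    (hrm : ∀ k < n, ∀ m : ℤ, (L : ℤ) * m ≤ rm k m ∧ rm k m ≤ L * m + (L - 1))
    {α₀ : ℝ} (hα : 1 / (L : ℝ) ^ n < α₀) :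
    IsRegularSet (cover L rm n) (Real.log ((L : ℝ) - 1) / Real.log L) (2 * L) α₀ 1 := by
  set δ := Real.log ((L : ℝ) - 1) / Real.log L with hδ
  have hLr : (1 : ℝ) < L := by exact_mod_cast (show 1 < L by omega)
  have hL0 : (0 : ℝ) < L := by positivity
  have hL2 : (2 : ℝ) ≤ L := by exact_mod_cast hL
  have hq0 : (0 : ℝ) < (L : ℝ) - 1 := by linarith
  have hδ0 : 0 ≤ δ := delta_nonneg hL
  have hδ1 : δ ≤ 1 := (delta_lt_one hL).le
  have hqk : ∀ k : ℕ, (1 / (L : ℝ) ^ k) ^ δ = 1 / ((L : ℝ) - 1) ^ k :=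
    one_div_pow_rpow_delta hL
  refine ⟨cover_nonempty hL, isClosed_cover hL, coverMeasure L rm n, coverMeasure_compl hL, ?_⟩
  intro a b hab hα0 hb1
  set ℓ := b - a with hℓ
  have hℓ0 : 0 < ℓ := sub_pos.2 hab
  have hℓn : 1 / (L : ℝ) ^ n < ℓ := hα.trans_le hα0
  have hpn := Lpow_pos hL n
  have hn1 : 1 ≤ n := by
    rcases Nat.eq_zero_or_pos n with h0 | h0
    · rw [h0, pow_zero, div_one] at hℓn; linarith
    · exact h0
  constructor
  · /- UPPER BOUND: `[a,b] ⊆ I_{m,k} ∪ I_{m+1,k}` with `L^{-k-1} < ℓ ≤ L^{-k}`, `k < n`. -/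
    classical
    have hex : ∃ k : ℕ, 1 / (L : ℝ) ^ (k + 1) < ℓ := ⟨n - 1, by rwa [Nat.sub_add_cancel hn1]⟩
    set k := Nat.find hex with hk
    have hk1 : 1 / (L : ℝ) ^ (k + 1) < ℓ := Nat.find_spec hex
    have hkn : k ≤ n := by
      have : k ≤ n - 1 := Nat.find_le (by rwa [Nat.sub_add_cancel hn1])
      omega
    have hpk := Lpow_pos hL k
    set m : ℤ := ⌊a * (L : ℝ) ^ k⌋ with hm
    have hm1 : (m : ℝ) ≤ a * (L : ℝ) ^ k := Int.floor_le _
    have hm2 : a * (L : ℝ) ^ k < m + 1 := Int.lt_floor_add_one _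
    have hℓk : ℓ ≤ 1 / (L : ℝ) ^ k := by
      rcases Nat.eq_zero_or_pos k with h0 | hpos
      · rw [h0, pow_zero, div_one]; exact hb1
      · have := Nat.find_min hex (show k - 1 < k by omega)
        rw [Nat.sub_add_cancel hpos] at this
        exact not_lt.1 this
    have hcov : Icc a b ⊆ ladic L k m ∪ ladic L k (m + 1) := by
      intro x hx
      obtain ⟨hxa, hxb⟩ := hx
      have hxa' : a * (L : ℝ) ^ k ≤ x * (L : ℝ) ^ k := mul_le_mul_of_nonneg_right hxa hpk.le
      rw [ladic, ladic]
      by_cases hxm : x ≤ ((m : ℝ) + 1) / (L : ℝ) ^ k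
      · left
        refine ⟨?_, hxm⟩
        rw [div_le_iff₀ hpk]
        linarith
      · right
        have hxm' := not_le.1 hxm
        push_cast
        refine ⟨hxm'.le, ?_⟩
        rw [le_div_iff₀ hpk]
        have hxb' : x ≤ a + 1 / (L : ℝ) ^ k := by linarith
        have : x * (L : ℝ) ^ k ≤ a * (L : ℝ) ^ k + 1 := by
          calc x * (L : ℝ) ^ k ≤ (a + 1 / (L : ℝ) ^ k) * (L : ℝ) ^ k := by gcongr
            _ = a * (L : ℝ) ^ k + 1 := by rw [add_mul, one_div, inv_mul_cancel₀ hpk.ne']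
        linarith
    calc coverMeasure L rm n (Icc a b)
        ≤ coverMeasure L rm n (ladic L k m ∪ ladic L k (m + 1)) := measure_mono hcov
      _ ≤ coverMeasure L rm n (ladic L k m) + coverMeasure L rm n (ladic L k (m + 1)) :=
          measure_union_le _ _
      _ ≤ ENNReal.ofReal (1 / ((L : ℝ) - 1) ^ k) + ENNReal.ofReal (1 / ((L : ℝ) - 1) ^ k) :=
          add_le_add (coverMeasure_ladic_le hL hrm hkn m) (coverMeasure_ladic_le hL hrm hkn (m + 1))
      _ = ENNReal.ofReal (2 * (1 / (L : ℝ) ^ k) ^ δ) := by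
          rw [← ENNReal.ofReal_add (by positivity) (by positivity), hqk k, two_mul]
      _ ≤ ENNReal.ofReal (2 * L * ℓ ^ δ) := by
          refine ENNReal.ofReal_le_ofReal ?_
          have e : 1 / (L : ℝ) ^ k = L * (1 / (L : ℝ) ^ (k + 1)) := by rw [pow_succ]; field_simp
          rw [e, Real.mul_rpow hL0.le (by positivity), mul_assoc]
          refine mul_le_mul_of_nonneg_left ?_ (by norm_num)
          exact mul_le_mul (Real.rpow_le_self_of_one_le hLr.le hδ1)
            (Real.rpow_le_rpow (by positivity) hk1.le hδ0) (by positivity) hL0.le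
  · /- LOWER BOUND for `[a,b]` centred at `x ∈ X`. -/
    intro hmid
    set x := (a + b) / 2 with hx
    obtain ⟨c, hc, hxc⟩ := mem_cover.1 hmid
    rw [coverMeasure_apply measurableSet_Icc]
    rcases lt_or_ge ℓ (2 / (L : ℝ) ^ n) with hsmall | hlarge
    · /- below the bottom scale: `[a,b] ∩ I_{c,n}` contains an interval of length `ℓ/2`,
         and the density `(L/(L-1))^n = (L^{-n})^{δ-1} ≥ ℓ^{δ-1}` as `L^{-n} < ℓ`. -/
      have hxc' : (c : ℝ) / (L : ℝ) ^ n ≤ x ∧ x ≤ ((c : ℝ) + 1) / (L : ℝ) ^ n := hxc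
      set t : ℝ := min (max a ((c : ℝ) / (L : ℝ) ^ n)) (((c : ℝ) + 1) / (L : ℝ) ^ n - ℓ / 2)
        with ht
      have hℓw : ℓ / 2 < 1 / (L : ℝ) ^ n := by
        rw [lt_div_iff₀ hpn] at hsmall ⊢; linarith
      have hta : a ≤ t := le_min (le_max_left _ _) (by rw [hx] at hxc'; linarith [hxc'.2])
      have htq : (c : ℝ) / (L : ℝ) ^ n ≤ t := le_min (le_max_right _ _) (by
        have e : ((c : ℝ) + 1) / (L : ℝ) ^ n = (c : ℝ) / (L : ℝ) ^ n + 1 / (L : ℝ) ^ n := by ring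
        rw [e]; linarith)
      have htx : t ≤ x := (min_le_left _ _).trans (max_le (by rw [hx]; linarith) hxc'.1)
      have httop : t + ℓ / 2 ≤ ((c : ℝ) + 1) / (L : ℝ) ^ n := by
        linarith [min_le_right (max a ((c : ℝ) / (L : ℝ) ^ n)) (((c : ℝ) + 1) / (L : ℝ) ^ n - ℓ / 2)]
      have hJ : Icc t (t + ℓ / 2) ⊆ Icc a b ∩ cover L rm n := by
        intro y hy
        obtain ⟨hy1, hy2⟩ := hy
        have hxb : x + ℓ / 2 = b := by rw [hx, hℓ]; ring
        refine ⟨⟨by linarith, by linarith⟩, ladic_subset_cover hc ⟨by linarith, by linarith⟩⟩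
      have hw0 : (0 : ℝ) < 1 / (L : ℝ) ^ n := by positivity
      have hρ : (L : ℝ) ^ n / ((L : ℝ) - 1) ^ n = (1 / (L : ℝ) ^ n) ^ (δ - 1) := by
        rw [Real.rpow_sub_one hw0.ne', hqk n]
        field_simp
      have hmono : ℓ ^ (δ - 1) ≤ (1 / (L : ℝ) ^ n) ^ (δ - 1) :=
        Real.rpow_le_rpow_of_nonpos hw0 hℓn.le (by linarith)
      have hℓδ : ℓ ^ (δ - 1) * ℓ = ℓ ^ δ := by
        rw [Real.rpow_sub_one hℓ0.ne']; field_simp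
      calc ENNReal.ofReal ((2 * (L : ℝ))⁻¹ * ℓ ^ δ)
          ≤ ENNReal.ofReal ((L : ℝ) ^ n / ((L : ℝ) - 1) ^ n * (ℓ / 2)) := by
            refine ENNReal.ofReal_le_ofReal ?_
            calc (2 * (L : ℝ))⁻¹ * ℓ ^ δ ≤ 2⁻¹ * ℓ ^ δ := by
                  refine mul_le_mul_of_nonneg_right ?_ (by positivity)
                  exact inv_anti₀ (by norm_num) (by linarith)
              _ = 2⁻¹ * (ℓ ^ (δ - 1) * ℓ) := by rw [hℓδ]
              _ ≤ 2⁻¹ * ((1 / (L : ℝ) ^ n) ^ (δ - 1) * ℓ) := by gcongr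
              _ = (L : ℝ) ^ n / ((L : ℝ) - 1) ^ n * (ℓ / 2) := by rw [hρ]; ring
        _ = ENNReal.ofReal ((L : ℝ) ^ n / ((L : ℝ) - 1) ^ n) * volume (Icc t (t + ℓ / 2)) := by
            rw [Real.volume_Icc, show t + ℓ / 2 - t = ℓ / 2 by ring,
              ← ENNReal.ofReal_mul (by positivity)]
        _ ≤ ENNReal.ofReal ((L : ℝ) ^ n / ((L : ℝ) - 1) ^ n) * volume (Icc a b ∩ cover L rm n) :=
            mul_le_mul_of_nonneg_left (measure_mono hJ) (by positivity)
    · /- above the bottom scale: the level-`j` ancestor of `x`'s cell lies inside `[a,b]`,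
         where `2L^{-j} ≤ ℓ < 2L^{-(j-1)}`, `1 ≤ j ≤ n`. -/
      classical
      have hex : ∃ j : ℕ, 2 / (L : ℝ) ^ j ≤ ℓ := ⟨n, hlarge⟩
      set j := Nat.find hex with hj
      have hj1 : 2 / (L : ℝ) ^ j ≤ ℓ := Nat.find_spec hex
      have hjn : j ≤ n := Nat.find_le hlarge
      have hj0 : j ≠ 0 := by
        intro h0
        rw [h0, pow_zero, div_one] at hj1
        linarith
      obtain ⟨j', hj'⟩ : ∃ j', j = j' + 1 := Nat.exists_eq_succ_of_ne_zero hj0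
      have hj2 : ℓ < 2 / (L : ℝ) ^ j' := not_le.1 (Nat.find_min hex (show j' < j by omega))
      -- the ancestor cell
      set anc : ℤ := c / (L : ℤ) ^ (n - j) with hanc
      have hcn : Surv L rm (j + (n - j)) c := by rw [Nat.add_sub_cancel' hjn]; exact hc
      have hsanc : Surv L rm j anc := Surv.ediv_pow hL hcn
      have hxanc : x ∈ ladic L j anc :=
        ladic_add_subset_ladic_ediv hL j (n - j) c (by rw [Nat.add_sub_cancel' hjn]; exact hxc)
      have hpj := Lpow_pos hL j
      have hIsub : ladic L j anc ⊆ Icc a b := by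
        intro y hy
        have hdist := dist_le_of_mem_ladic hy hxanc
        have h2 : 1 / (L : ℝ) ^ j ≤ ℓ / 2 := by
          rw [div_le_iff₀ hpj] at hj1 ⊢; linarith
        have hxb : x + ℓ / 2 = b := by rw [hx, hℓ]; ring
        have hxa : x - ℓ / 2 = a := by rw [hx, hℓ]; ring
        rw [abs_le] at hdist
        constructor <;> linarith [hdist.1, hdist.2]
      have hcmp : ℓ / (2 * L) < 1 / (L : ℝ) ^ j := by
        rw [hj', pow_succ, div_lt_iff₀ (by positivity : (0 : ℝ) < 2 * L)]
        calc ℓ < 2 / (L : ℝ) ^ j' := hj2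
          _ = 1 / ((L : ℝ) ^ j' * L) * (2 * L) := by field_simp
      calc ENNReal.ofReal ((2 * (L : ℝ))⁻¹ * ℓ ^ δ)
          ≤ ENNReal.ofReal (1 / ((L : ℝ) - 1) ^ j) := by
            refine ENNReal.ofReal_le_ofReal ?_
            calc (2 * (L : ℝ))⁻¹ * ℓ ^ δ = ℓ ^ δ / (2 * L) := by ring
              _ ≤ ℓ ^ δ / (2 * L) ^ δ := div_le_div_of_nonneg_left (by positivity) (by positivity)
                  (Real.rpow_le_self_of_one_le (by linarith) hδ1)
              _ = (ℓ / (2 * L)) ^ δ := (Real.div_rpow hℓ0.le (by positivity) δ).symm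
              _ ≤ (1 / (L : ℝ) ^ j) ^ δ := Real.rpow_le_rpow (by positivity) hcmp.le hδ0
              _ = 1 / ((L : ℝ) - 1) ^ j := hqk j
        _ ≤ coverMeasure L rm n (ladic L j anc) := le_coverMeasure_ladic hL hrm hjn hsanc
        _ = ENNReal.ofReal ((L : ℝ) ^ n / ((L : ℝ) - 1) ^ n) * volume (ladic L j anc ∩ cover L rm n) :=
            coverMeasure_apply (measurableSet_ladic L j anc)
        _ ≤ ENNReal.ofReal ((L : ℝ) ^ n / ((L : ℝ) - 1) ^ n) * volume (Icc a b ∩ cover L rm n) :=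
            mul_le_mul_of_nonneg_left (measure_mono (inter_subset_inter_left _ hIsub)) (by positivity)

end Regularity

end PorousCover

/-! ### Main result -/

/-- **Porous sets are contained in `δ`-regular sets with `δ < 1`** (Dyatlov–Jin 2018, Lemma 5.4;
Dyatlov 2019, Proposition 1(2): "Assume that `X` is `ν`-porous on scales `α_min` to `α_max`.
Then `X` is contained in some set `Y ⊂ ℝ` which is `δ`-regular with constant `C_R` on scales
`α_min` to `α_max` where `δ < 1` and `C_R` depend only on `ν`"), here for `α_max = 1` and sets in
`[-1, 1]`, in Bourgain–Dyatlov's sense `IsRegularSet` (upper mass bound on all intervals, lower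
bound on intervals centred on the set): for every `ν ∈ (0,1)` there exist `δ ∈ [0,1)` and
`C_R ≥ 1` (explicitly `L = ⌈2/ν⌉`, `δ = log(L-1)/log L`, `C_R = 2L`) such that for all
`0 < α₀ ≤ 1` and all `Ω ⊆ [-1,1]` which are `ν`-porous on scales `α₀` to `1` there is a set `X`
with `Ω ⊆ X ⊆ [-1,1]` which is (nonempty, closed and) `δ`-regular with constant `C_R` on scales
`α₀` to `1`. This is the covering step in the proof of the FUP for porous sets. [cite: DyatlovJin2018Acta, Lemma 5.4] [cite: Dyatlov2019, §2.2 Proposition 1(2)] [cite: DyatlovJinNonnenmacher2021, §2.4, proof of Prop. 2.9, Step 4] -/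
theorem exists_regular_superset_of_porous {ν : ℝ} (hν0 : 0 < ν) (hν1 : ν < 1) :
    ∃ δ : ℝ, 0 ≤ δ ∧ δ < 1 ∧ ∃ C_R : ℝ, 1 ≤ C_R ∧
      ∀ α₀ : ℝ, 0 < α₀ → α₀ ≤ 1 → ∀ Ω : Set ℝ, Ω ⊆ Icc (-1) 1 → IsPorousOnScales Ω ν α₀ 1 →
        ∃ X : Set ℝ, Ω ⊆ X ∧ X ⊆ Icc (-1) 1 ∧ IsRegularSet X δ C_R α₀ 1 := by
  set L : ℕ := ⌈2 / ν⌉₊ with hLdef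
  have hL2ν : 2 / ν ≤ (L : ℝ) := Nat.le_ceil _
  have h2lt : (2 : ℝ) < 2 / ν := by rw [lt_div_iff₀ hν0]; linarith
  have hL : 2 ≤ L := by
    have h : (2 : ℝ) < L := h2lt.trans_le hL2ν
    exact_mod_cast h.le
  have hνL : 2 ≤ ν * L := by rw [div_le_iff₀ hν0] at hL2ν; linarith
  have hLr : (1 : ℝ) < L := by exact_mod_cast (show 1 < L by omega)
  have hL2 : (2 : ℝ) ≤ L := by exact_mod_cast hL
  refine ⟨Real.log ((L : ℝ) - 1) / Real.log L, PorousCover.delta_nonneg hL,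
    PorousCover.delta_lt_one hL, 2 * L, by linarith, ?_⟩
  intro α₀ hα0 _ Ω hΩ hP
  have hex : ∃ n : ℕ, 1 / (L : ℝ) ^ n < α₀ := by
    obtain ⟨n, hn⟩ := pow_unbounded_of_one_lt (1 / α₀) hLr
    refine ⟨n, ?_⟩
    have hpn : (0 : ℝ) < (L : ℝ) ^ n := by positivity
    rw [div_lt_iff₀ hpn]
    rw [div_lt_iff₀ hα0] at hn
    linarith
  classical
  set n := Nat.find hex with hn
  have hnα : 1 / (L : ℝ) ^ n < α₀ := Nat.find_spec hex
  have hscale : ∀ k < n, α₀ ≤ 1 / (L : ℝ) ^ k := fun k hk => not_lt.1 (Nat.find_min hex hk)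
  obtain ⟨rm, hrm1, hrm2⟩ := PorousCover.exists_removal hL hνL hP hscale
  exact ⟨PorousCover.cover L rm n, PorousCover.subset_cover hL hΩ hrm2,
    PorousCover.cover_subset_Icc hL, PorousCover.isRegularSet_cover hL hrm1 hnα⟩

end Literature.Analysis.Fourier
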